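import Summits.AtomisticToContinuum.FouriersLaw.Theses.HonestZwanzig
import Summits.AtomisticToContinuum.FouriersLaw.Theorems.EmbeddedDrudeMourreFiniteResponseOfUnique
import Summits.AtomisticToContinuum.FouriersLaw.Theorems.HonestZwanzigOpenChainGreenKuboKuboPairing
import Summits.AtomisticToContinuum.FouriersLaw.Theorems.OddSectorIrreversibilityOddDensityIsCorrectorDetailedBalance
import Summits.AtomisticToContinuum.FouriersLaw.Theorems.JunctionLocalityNonBallisticStubOpenChainGreenKuboAux1

/-!
# `OpenChainGreenKubo` (stmt-AtomisticToContinuum-12696) from `ResponseDensity` and `OddDensityIsCorrector`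

Helper file (`--supports`) for the support item `HonestZwanzig.OpenChainGreenKubo`. The second closing path of the
item, through two EXISTING items of route `OddSectorIrreversibility`:

* `ResponseDensity` (stmt-AtomisticToContinuum-9144) — under weak-NESS uniqueness every steady family has an `L²(μ_T)`
  linear-response density `h` at equal temperatures, on test functions and on the bond currents;
* `OddDensityIsCorrector` (stmt-AtomisticToContinuum-9146) — for any such `h`, its odd part is the Kubo corrector:
  `h - h∘Θ = (u - u∘Θ)/((N-1)T²)` a.e. with `u = lim_τ ∫₀^τ P_t J dt` in `L²(μ_T)`.

Then `OpenChainGreenKubo` follows (`openChainGreenKubo_of_responseDensity_of_oddDensityIsCorrector`): the response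
quotient tends to `Σ_i ∫ j_i h dμ_T = ∫ J h dμ_T` (per-bond bookkeeping of the tree,
`FiniteResponse.tendsto_response_of_bond_quotients`); by momentum reversal (`J` odd, `μ_T` reversal invariant)
`∫ J h dμ_T = ½∫ J (h - h∘Θ) dμ_T = ½∫ J (u - u∘Θ) dμ_T/((N-1)T²) = ∫ J u dμ_T/((N-1)T²)`; `u` is a.e. the everywhere-defined
corrector `∫₀^∞ P_t J dt` (`corrector_exists`), and `∫ J (∫₀^∞ P_t J) dμ_T = ∫₀^∞ ∫ J P_t J dμ_T dt = ∫₀^∞ corr(J,J)` (Fubini,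
`integral_Ioi_integral_nice_mul_act`, `μ_T(J) = 0`). Clause (i) is the tree's `NonBallistic.pinnedChain_integrableOn_totalCorr`.
No definitions.
-/

noncomputable section

open MeasureTheory Filter Topology Set Function
open scoped NNReal ENNReal BigOperators

namespace Summit.AtomisticToContinuum.FouriersLaw.Theorems.OpenChainGreenKubo

open Literature.MathematicalPhysics.KineticTheory.HeatConduction
open Literature.MathematicalPhysics.KineticTheory OscillatorChain
open Summit.AtomisticToContinuum.FouriersLaw.Theorems.OddSectorIrreversibility
open Summit.AtomisticToContinuum.FouriersLaw.Theorems.OddSectorIrreversibility.Corrector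
open Summit.AtomisticToContinuum.FouriersLaw.Theorems.LightConeBondHeat

variable {N : ℕ}

section Pairing

variable {ω₂ lam β γ : ℝ} (hω : 0 < ω₂) (hl : 0 < lam) (hβ : 0 < β) (hγ : 0 < γ) (hN : 2 ≤ N)
  {T : ℝ} (hT : 0 < T)
include hω hl hβ hγ hN hT

omit hγ in
/-- **The odd part of an `L²` density pairs with `J` like the Kubo corrector.** If `h, u ∈ L²(μ_T)` satisfy
`h - h∘Θ = (u - u∘Θ)/((N-1)T²)` a.e., then `∫ J h dμ_T = ∫ J u dμ_T / ((N-1)T²)` (`J` is odd and `μ_T` is reversal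
invariant, so `∫ J k dμ_T = ½ ∫ J (k - k∘Θ) dμ_T` for every `k ∈ L²`). [folklore] -/
theorem integral_current_mul_eq_of_odd_parts {h u : PhaseSpace N → ℝ}
    (hh : MemLp h 2 ((pinnedChain ω₂ lam β γ).gibbsMeasure N T))
    (hu : MemLp u 2 ((pinnedChain ω₂ lam β γ).gibbsMeasure N T))
    (hodd : ∀ᵐ x ∂((pinnedChain ω₂ lam β γ).gibbsMeasure N T),
      h x - h (x.1, -x.2) = (u x - u (x.1, -x.2)) / (((N : ℝ) - 1) * T ^ 2)) :
    ∫ x, (∑ i : Fin N, (pinnedChain ω₂ lam β γ).bondCurrent N i x) * h x ∂((pinnedChain ω₂ lam β γ).gibbsMeasure N T) =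
      (∫ x, (∑ i : Fin N, (pinnedChain ω₂ lam β γ).bondCurrent N i x) * u x ∂((pinnedChain ω₂ lam β γ).gibbsMeasure N T)) /
        (((N : ℝ) - 1) * T ^ 2) := by
  set P := pinnedChain ω₂ lam β γ with hP
  set μ := P.gibbsMeasure N T with hμ
  haveI : IsProbabilityMeasure μ := pinnedChain_isProbabilityMeasure_gibbsMeasure hω hl.le hβ.le γ N hT
  set J : PhaseSpace N → ℝ := fun y => ∑ i : Fin N, P.bondCurrent N i y with hJ
  have hN1 : (0 : ℝ) < ((N : ℝ) - 1) * T ^ 2 := by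
    have : (2 : ℝ) ≤ N := by exact_mod_cast hN
    have h1 : (0 : ℝ) < (N : ℝ) - 1 := by linarith
    positivity
  have hmp := measurePreserving_reversal_gibbsMeasure P N T
  -- `J ∈ L²(μ_T)`
  have hJc : Continuous J := continuous_totalBondCurrent ω₂ lam β γ N
  have hϑ : (0 : ℝ) < 1 / T / 4 := by positivity
  obtain ⟨M, hM, hJM⟩ := abs_totalBondCurrent_le_exp hω.le hl.le hβ.le γ N hϑ
  have hJ2 : Integrable (fun y => J y ^ 2) μ := by
    have h2ϑ : 2 * (1 / T / 4) < 1 / T := by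
      have : 0 < 1 / T := by positivity
      linarith
    have hexp := pinnedChain_integrable_exp_mul_hamiltonian_gibbsMeasure hω hl.le hβ.le γ N hT h2ϑ
    refine (hexp.const_mul (M ^ 2)).mono' (hJc.pow 2).aestronglyMeasurable (Eventually.of_forall fun y => ?_)
    rw [Real.norm_eq_abs, abs_pow, show 2 * (1 / T / 4) * P.hamiltonian N y =
      (1 / T / 4) * P.hamiltonian N y + (1 / T / 4) * P.hamiltonian N y by ring, Real.exp_add]
    have h := hJM y
    have h0 : 0 ≤ |J y| := abs_nonneg _
    calc |J y| ^ 2 ≤ (M * Real.exp (1 / T / 4 * P.hamiltonian N y)) ^ 2 := pow_le_pow_left₀ h0 h 2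
      _ = _ := by ring
  -- integrability of the pairings, with `k` and with `k∘Θ`
  have hpair : ∀ {k : PhaseSpace N → ℝ}, MemLp k 2 μ →
      Integrable (fun x => J x * k x) μ ∧ Integrable (fun x => J x * k (x.1, -x.2)) μ ∧
        ∫ x, J x * k x ∂μ = -∫ x, J x * k (x.1, -x.2) ∂μ := by
    intro k hk
    have hkΘ : MemLp (fun x : PhaseSpace N => k (x.1, -x.2)) 2 μ := by
      have h := hk.comp_measurePreserving hmp
      exact h
    refine ⟨integrable_mul_of_integrable_sq hJc.aestronglyMeasurable hk.1 hJ2 hk.integrable_sq,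
      integrable_mul_of_integrable_sq hJc.aestronglyMeasurable hkΘ.1 hJ2 hkΘ.integrable_sq, ?_⟩
    have hrev := integral_comp_reversal_gibbsMeasure P N T (fun x => J x * k x)
    simp only [hJ, totalBondCurrent_neg_momentum, neg_mul, integral_neg] at hrev ⊢
    linarith
  obtain ⟨iJh, iJhΘ, eh⟩ := hpair hh
  obtain ⟨iJu, iJuΘ, eu⟩ := hpair hu
  -- `2 ∫ J h = ∫ J (h - h∘Θ) = ∫ J (u - u∘Θ)/c = 2 ∫ J u / c`
  have e1 : 2 * ∫ x, J x * h x ∂μ = ∫ x, J x * (h x - h (x.1, -x.2)) ∂μ := by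
    have : ∫ x, J x * (h x - h (x.1, -x.2)) ∂μ = (∫ x, J x * h x ∂μ) - ∫ x, J x * h (x.1, -x.2) ∂μ := by
      rw [← integral_sub iJh iJhΘ]
      exact integral_congr_ae (Eventually.of_forall fun x => by ring)
    rw [this]; linarith
  have e2 : ∫ x, J x * (h x - h (x.1, -x.2)) ∂μ = (∫ x, J x * (u x - u (x.1, -x.2)) ∂μ) / (((N : ℝ) - 1) * T ^ 2) := by
    rw [← integral_div]
    refine integral_congr_ae (hodd.mono fun x hx => ?_)
    simp only
    rw [hx, mul_div_assoc]
  have e3 : ∫ x, J x * (u x - u (x.1, -x.2)) ∂μ = 2 * ∫ x, J x * u x ∂μ := by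
    have : ∫ x, J x * (u x - u (x.1, -x.2)) ∂μ = (∫ x, J x * u x ∂μ) - ∫ x, J x * u (x.1, -x.2) ∂μ := by
      rw [← integral_sub iJu iJuΘ]
      exact integral_congr_ae (Eventually.of_forall fun x => by ring)
    rw [this]; linarith
  have key : 2 * ∫ x, J x * h x ∂μ = 2 * ((∫ x, J x * u x ∂μ) / (((N : ℝ) - 1) * T ^ 2)) := by
    rw [e1, e2, e3]; ring
  linarith

end Pairing

/-- **`OpenChainGreenKubo` from `ResponseDensity` (stmt-9144) and `OddDensityIsCorrector` (stmt-9146).** See the module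
docstring for the proof. [cite: KunduDharNarayan2009, p. 3] -/
theorem openChainGreenKubo_of_responseDensity_of_oddDensityIsCorrector
    (hRD : Summit.AtomisticToContinuum.FouriersLaw.Theses.OddSectorIrreversibility.ResponseDensity)
    (hODC : Summit.AtomisticToContinuum.FouriersLaw.Theses.OddSectorIrreversibility.OddDensityIsCorrector) :
    Summit.AtomisticToContinuum.FouriersLaw.Theses.HonestZwanzig.OpenChainGreenKubo := by
  intro ω₂ lam β γ hω hl hβ hγ huniq μf hμf T hT N hN
  refine ⟨NonBallistic.pinnedChain_integrableOn_totalCorr ω₂ lam β γ hω hl.le hβ hγ N (by omega) T hT, ?_⟩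
  set P := pinnedChain ω₂ lam β γ with hP
  have hN0 : 0 < N := by omega
  -- the response density and its odd part
  obtain ⟨h, hh2, hF, hbond⟩ := hRD ω₂ lam β γ hω hl hβ hγ huniq μf hμf T hT N
  obtain ⟨u, hu2, hlim, hodd⟩ := hODC ω₂ lam β γ hω hl hβ hγ huniq μf hμf T hT N h hN ⟨hh2, hF, hbond⟩
  have hG : μf N T T = P.gibbsMeasure N T :=
    FiniteResponse.steadyState_eq_gibbsMeasure_of_unique hω hl.le hβ.le hT (huniq N T T hT hT) (hμf N T T hT hT)
  rw [hG] at hh2 hbond hu2 hlim hodd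
  set μ := P.gibbsMeasure N T with hμ
  haveI : IsProbabilityMeasure μ := pinnedChain_isProbabilityMeasure_gibbsMeasure hω hl.le hβ.le γ N hT
  set J : PhaseSpace N → ℝ := fun y => ∑ i : Fin N, P.bondCurrent N i y with hJ
  -- the response of the total current is `Σ_i ∫ j_i h dμ_T`
  have hresp : Tendsto (fun δ : ℝ => P.totalCurrent (μf N (T + δ / 2) (T - δ / 2)) / δ) (𝓝[≠] 0)
      (𝓝 (∑ i : Fin N, ∫ x, P.bondCurrent N i x * h x ∂μ)) := by
    refine FiniteResponse.tendsto_response_of_bond_quotients P (μf N) T _ (fun i => ?_) (fun i => ?_)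
    · rw [hG]; exact pinnedChain_integral_bondCurrent_gibbsMeasure ω₂ lam β γ N T i
    · rw [hG]
      exact hbond i
  -- `Σ_i ∫ j_i h = ∫ J h`
  have hJc : Continuous J := continuous_totalBondCurrent ω₂ lam β γ N
  have hϑ0 : (0 : ℝ) < 1 / T / 4 := by positivity
  have h2ϑ : 2 * (1 / T / 4) < 1 / T := by
    have : 0 < 1 / T := by positivity
    linarith
  have hji : ∀ i : Fin N, Integrable (fun x => P.bondCurrent N i x * h x) μ := by
    intro i
    obtain ⟨Mi, hMi, hbMi⟩ : ∃ M : ℝ, 0 ≤ M ∧ ∀ y, |P.bondCurrent N i y| ≤ M * Real.exp (1 / T / 4 * P.hamiltonian N y) :=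
      ⟨_, by positivity, fun y => pinnedChain_abs_bondCurrent_le_exp hω.le hl.le hβ.le γ N hϑ0 i y⟩
    have hexp := pinnedChain_integrable_exp_mul_hamiltonian_gibbsMeasure hω hl.le hβ.le γ N hT h2ϑ
    have hci : Continuous (P.bondCurrent N i) := pinnedChain_continuous_bondCurrent ω₂ lam β γ N i
    have hsq : Integrable (fun y => P.bondCurrent N i y ^ 2) μ := by
      refine (hexp.const_mul (Mi ^ 2)).mono' (hci.pow 2).aestronglyMeasurable (Eventually.of_forall fun y => ?_)
      rw [Real.norm_eq_abs, abs_pow, show 2 * (1 / T / 4) * P.hamiltonian N y =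
        (1 / T / 4) * P.hamiltonian N y + (1 / T / 4) * P.hamiltonian N y by ring, Real.exp_add]
      calc |P.bondCurrent N i y| ^ 2 ≤ (Mi * Real.exp (1 / T / 4 * P.hamiltonian N y)) ^ 2 :=
          pow_le_pow_left₀ (abs_nonneg _) (hbMi y) 2
        _ = _ := by ring
    exact integrable_mul_of_integrable_sq hci.aestronglyMeasurable hh2.1 hsq hh2.integrable_sq
  have hsum : (∑ i : Fin N, ∫ x, P.bondCurrent N i x * h x ∂μ) = ∫ x, J x * h x ∂μ := by
    rw [← integral_finsetSum _ fun i _ => hji i]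
    refine integral_congr_ae (Eventually.of_forall fun x => ?_)
    simp only [hJ, Finset.sum_mul]
  -- `∫ J h = ∫ J u / ((N-1)T²)` and `u` is a.e. the corrector `w = ∫₀^∞ P_t J`
  have hpar := integral_current_mul_eq_of_odd_parts hω hl hβ hN hT hh2 hu2 hodd
  obtain ⟨K, c, hK, hc, -, hwm, hwb, -, hwlim, -⟩ := corrector_exists hω hl hβ hγ hT hN0 hϑ0 h2ϑ _ rfl _ rfl
  have huw : u =ᵐ[μ] fun z => ∫ s in Ioi (0 : ℝ),
      ∫ y, (∑ i : Fin N, P.bondCurrent N i y) ∂(P.transitionKernel N T T s.toNNReal z) :=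
    hlim.mono fun z hz => tendsto_nhds_unique hz (hwlim z)
  have hJu : ∫ x, J x * u x ∂μ = ∫ x, J x * (∫ s in Ioi (0 : ℝ),
      ∫ y, (∑ i : Fin N, P.bondCurrent N i y) ∂(P.transitionKernel N T T s.toNNReal x)) ∂μ :=
    integral_congr_ae (huw.mono fun x hx => by simp only; rw [hx])
  -- Fubini: `∫ J (∫₀^∞ P_t J) dμ_T = ∫₀^∞ ∫ J P_t J dμ_T dt`
  obtain ⟨M, hM0, hJM⟩ := abs_totalBondCurrent_le_exp hω.le hl.le hβ.le γ N hϑ0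
  have hJ0 : ∫ y, J y ∂μ = 0 := integral_totalBondCurrent_gibbsMeasure ω₂ lam β γ N T
  have hFub := integral_Ioi_integral_nice_mul_act hω hl.le hβ hγ hN0 hT hϑ0 h2ϑ hJc hJc hM0 hJM hJM hJ0
  -- assemble the limit value
  have hval : (∑ i : Fin N, ∫ x, P.bondCurrent N i x * h x ∂μ) =
      (∫ t in Ioi (0 : ℝ), ((∫ z, J z * (∫ y, J y ∂(P.transitionKernel N T T t.toNNReal z)) ∂μ) -
        (∫ z, J z ∂μ) * (∫ z, J z ∂μ))) / (((N : ℝ) - 1) * T ^ 2) := by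
    rw [hsum, hpar, hJu, ← hFub]
    simp only [hJ0, mul_zero, sub_zero]
    rfl
  rw [hval] at hresp
  exact hresp

end Summit.AtomisticToContinuum.FouriersLaw.Theorems.OpenChainGreenKubo

end
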